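import Summits.QuantumFields.BalabanUV.Beta.GAN24.StencilSlotLam
import Literature.MathematicalPhysics.QuantumFieldTheory.Balaban1983to89.Beta.AveragingHessianKernelsRooted

/-!
# `BalabanUV.Beta.GAN24.StencilSlotLamRoot` — binder row G-an2-4 / (CONV-C), S-slot AFTER the K-slot: the ROOTED TWIN of `GAN24/StencilSlotLam`
# (p204120) — the LAGRANGE summand (P-Λ) with an1's ROOTED per-bond W-Hessian `hessFFAt ρ` in place of `hessFF` (the Λ sector of the literal of
# record `WardLocusRecursive.SrecAt ρ`, and of an2's `SpineRootedStepN.SstepNAt ρ` / `SpineRootedStep.SstepAt ρ`): in the adopted units it is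
# `(cΛ·Lc^{2(d+1)}) • S^Λ` of the UNIT-NORMALISED step resolvents over `hessFFAt ρ`, hence `j`-uniformly local from `UnitDecayK` alone — row SR-L0
# «UNITS ENGINE», Λ LINE (and its SR-L2 locality half), of the row owner's `HOME/b2b-balaban-gan24-p1/SKELETON-SREC.md` v0.1 §2; RULINGS-15 (R15-3)
# «SREC-ROOT» (G-an2-4 swarm leaf seat `b2b-balaban-gan24-formalise-leaf-03`, gen 40)

NOT IN PRINT; OUR BOOKKEEPING (the row owner's `gen6/mkroot.py` METHOD: the §4 proofs of the base module VERBATIM, the per-bond Hessian entering only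
through an1's ROOTED lemma `AveragingHessianKernelsRooted.biLoc_hessFFAt` — box root `r ∈ box (d+1) Lc` — instead of `AveragingHessianKernels.biLoc_hessFF`,
and its block-support `hessFFAt_inl_inr` / `hessFFAt_inr`; the generic algebra and the `E″`-dictionary of the base module — `SLam_entry_zero`, `SLam_smul`,
`unitS_smul_ffOnly`, `lamCoeffK_unit`, `E2_inr`, `decays_E2unit`, `lam_unit_factor` — are used BY NAME, not re-declared).  HONEST FRAMING (cell contract,
verbatim): «discharging `BetaPertH` makes Bałaban's UV stability UNCONDITIONAL — a real constructive-QFT result; it is NOT the continuum limit and NOT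
the Clay problem.»  HONEST DEPENDENCY (verbatim): «continuum YM on T⁴ ⇐ BetaPertH ∧ nine spine estimates (0/9 proved); BetaPertH ⇐ (D1) ∧ (D4) ∧
CAP+tail; G-an2-4 gates asym, D1 and NE2/3/4.»  [folklore] bookkeeping over the tree's own definitions (asym1's `unitS`/`unitK`, an2's `E2`, `lamCoeffK`,
`wΛ = (Lc^n)^{4(d+2)}`, `InterLevelTransport.SLam`, an1's `hessFFAt`) plus the composition brick `BalabanStepJetsSucc.abs_lamCoeffK_le` BY NAME; no estimate,
no cited fact, no `def`, no `def … : Prop`, no sorry.  The K-slot data enter as the HYPOTHESIS `UnitDecayK d Lc (sfStep Lc) (smStep d Lc) C δ`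
(`GAN24.CombesThomas`; for `d = 3` concluded by road P1, `GAN24/FibreStrip.unitDecayK_holds`) — asserted nowhere here.  Discharges NOTHING of (hS, hSall)
on ANY literal: the Λ summand is ONE of three summands of the members `j + 1` (cubic: `GAN24/SrecUnits` p226440; border: `GAN24/StencilSlotVHRoot`); the drift
half is `GAN24/StencilSlotLamDriftRoot`; 0 wall binders instantiated; NEVER «G-an2-4 closed» as (CONV-C); NOT D1, NOT BetaPertH, NOT continuum, NOT Clay.

## What is proved (generic `d`; `Lc` with `NeZero Lc`; `n = j + 1 ≥ 1`; any root offset `ρ` for the algebra, an in-block root `toSite r` for the locality)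
The rooted (P-Λ) summand of member `j + 1` is
`fun κ u ↦ (cΛ * wΛ d Lc (j+1)) • SLam Lc (lamCoeffK (KInvStep Lc (j+1)) (E2 d Lc (j+1)) Lc) (fun μ y ↦ hessFFAt ρ Lc μ y) κ u` (verbatim `SrecAt_succ`).
* §1 `SLam_hessFFAt_inl_inr` / `_inr_inl` / `_inr_inr`: `S^Λ` over `hessFFAt ρ` vanishes off the field–field block.
* §2 **`unitS_lamPiece_eq`** (any `ρ`): `unitS (sfStep Lc (j+1)) (smStep d Lc (j+1)) (rooted Λ-summand at j+1) = fun κ u ↦ (cΛ * Lc^{2(d+1)}) •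
  SLam Lc (lamCoeffK (KStepUnit Lc (j+1)) ((smStep d Lc j)^2 • E2 d Lc (j+1)) Lc) (fun μ y ↦ hessFFAt ρ Lc μ y) κ u` — the normalised rooted Λ-summand
  is `S^Λ` of the UNIT-NORMALISED resolvents with the `j`-FREE weight `cΛ·Lc^{2(d+1)}` (`lam_unit_factor`); **`locStencil_unitS_lamPiece`** (`ρ = toSite r`,
  `r ∈ box (d+1) Lc`, `1 ≤ Lc`, `0 < δ`): from `UnitDecayK d Lc (sfStep Lc) (smStep d Lc) C δ` the `hS`-shape for this summand at EVERY member `j + 1` with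
  ONE `j`-FREE constant `|cΛ·Lc^{2(d+1)}| · (d+1)·(|Fib d|·C²·Zl(δ/2) · 2ℓ²e^{2(d+1)Lcδ} · Zl(δ/4))`, rate `δ/4` (`ℓ = ell (d+1) Lc`) — the base module's constant.
-/

noncomputable section

open Literature.MathematicalPhysics.QuantumFieldTheory
open Literature.MathematicalPhysics.QuantumFieldTheory.Balaban1983to89
open Literature.MathematicalPhysics.QuantumFieldTheory.Balaban1983to89.Beta
open B12Sec2to5 (l1 l1_nonneg)
open ExpKernelCalculus (MKer Decays BiLoc VertexFamily Zl Zl_nonneg)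
open OneStepResolventKernel (Fib LocStencil)
open OneStepKernelFamily (KInvStep)
open AffineAveraging (box toSite)
open InterLevelTransport (SLam locStencil_SLam)
open AveragingHessianKernels (ell)
open AveragingHessianKernelsRooted (hessFFAt hessFFAt_inl_inr hessFFAt_inr biLoc_hessFFAt)
open BalabanStepJetsSucc (wΛ E2 lamCoeffK abs_lamCoeffK_le)
open Summit.QuantumFields.BalabanUV.Beta.HessKerDressedUnits (unitS)
open Summit.QuantumFields.BalabanUV.Beta.GAN24.CombesThomas (sfStep smStep sfStep_ne_zero smStep_ne_zero KStepUnit UnitDecayK)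
open Summit.QuantumFields.BalabanUV.Beta.GAN24.StencilSlotLam (SLam_entry_zero SLam_smul unitS_smul_ffOnly lamCoeffK_unit E2_inr
  decays_E2unit lam_unit_factor)

namespace Summit.QuantumFields.BalabanUV.Beta.GAN24.StencilSlotLamRoot

variable {d : ℕ}

/-! ## §1 Block support of `S^Λ` over the rooted per-bond Hessian -/

section SLamAlgebra

variable {N : ℕ} [NeZero N]

/-- [folklore] `S^Λ` built on an1's rooted `hessFFAt ρ` vanishes on the `(inl, inr)` block. -/
theorem SLam_hessFFAt_inl_inr (c : Fin (d + 1) → (Fin (d + 1) → ℤ) → Fin (d + 1) → (Fin (d + 1) → ℤ) → ℝ) (ρ : Fin (d + 1) → ℤ)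
    (L : ℕ) (κ : Fin (d + 1)) (u x z : Fin (d + 1) → ℤ) (α ν : Fin (d + 1)) :
    SLam N c (fun μ y => hessFFAt ρ L μ y) κ u x z (Sum.inl α) (Sum.inr ν) = 0 :=
  SLam_entry_zero c (fun μ y => hessFFAt_inl_inr ρ L μ y x z α ν) κ u

/-- [folklore] `S^Λ` built on `hessFFAt ρ` vanishes on the `(inr, inl)` block. -/
theorem SLam_hessFFAt_inr_inl (c : Fin (d + 1) → (Fin (d + 1) → ℤ) → Fin (d + 1) → (Fin (d + 1) → ℤ) → ℝ) (ρ : Fin (d + 1) → ℤ)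
    (L : ℕ) (κ : Fin (d + 1)) (u x z : Fin (d + 1) → ℤ) (ν α : Fin (d + 1)) :
    SLam N c (fun μ y => hessFFAt ρ L μ y) κ u x z (Sum.inr ν) (Sum.inl α) = 0 :=
  SLam_entry_zero c (fun μ y => hessFFAt_inr ρ L μ y x z ν (Sum.inl α)) κ u

/-- [folklore] `S^Λ` built on `hessFFAt ρ` vanishes on the `(inr, inr)` block. -/
theorem SLam_hessFFAt_inr_inr (c : Fin (d + 1) → (Fin (d + 1) → ℤ) → Fin (d + 1) → (Fin (d + 1) → ℤ) → ℝ) (ρ : Fin (d + 1) → ℤ)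
    (L : ℕ) (κ : Fin (d + 1)) (u x z : Fin (d + 1) → ℤ) (ν ν' : Fin (d + 1)) :
    SLam N c (fun μ y => hessFFAt ρ L μ y) κ u x z (Sum.inr ν) (Sum.inr ν') = 0 :=
  SLam_entry_zero c (fun μ y => hessFFAt_inr ρ L μ y x z ν (Sum.inr ν')) κ u

end SLamAlgebra

/-! ## §2 The normalised rooted Lagrange summand = `S^Λ` of the unit-normalised resolvents over `hessFFAt ρ`; `j`-uniform locality from `UnitDecayK` -/

section Main

variable {Lc : ℕ} [NeZero Lc]

/-- [folklore] **THE NORMALISED ROOTED (P-Λ) SUMMAND** of member `j + 1` (any root offset `ρ`): in the K-slot's units it is `(cΛ·Lc^{2(d+1)}) • S^Λ`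
with coefficients `lamCoeffK (KStepUnit Lc (j+1)) ((s_m j)^2 • E2 d Lc (j+1)) Lc` over `hessFFAt ρ` — built from the UNIT-NORMALISED step resolvents of
levels `j + 1` and `j` (base proof verbatim: `lamCoeffK_unit`, `SLam_smul`, `unitS_smul_ffOnly`, `lam_unit_factor` BY NAME). -/
theorem unitS_lamPiece_eq (ρ : Fin (d + 1) → ℤ) (cΛ : ℝ) (j : ℕ) :
    unitS (sfStep Lc (j + 1)) (smStep d Lc (j + 1))
        (fun κ u => (cΛ * wΛ d Lc (j + 1)) •
          SLam Lc (lamCoeffK (KInvStep (d := d) Lc (j + 1)) (E2 d Lc (j + 1)) Lc) (fun μ y => hessFFAt ρ Lc μ y) κ u)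
      = fun κ u => (cΛ * (Lc : ℝ) ^ (2 * (d + 1))) •
          SLam Lc (lamCoeffK (KStepUnit (d := d) Lc (j + 1)) ((smStep d Lc j) ^ 2 • E2 d Lc (j + 1)) Lc)
            (fun μ y => hessFFAt ρ Lc μ y) κ u := by
  have hsf : sfStep Lc (j + 1) ≠ 0 := sfStep_ne_zero (j + 1)
  have hsm : smStep d Lc (j + 1) ≠ 0 := smStep_ne_zero (d := d) (j + 1)
  have ht : (smStep d Lc j) ^ 2 ≠ 0 := pow_ne_zero 2 (smStep_ne_zero (d := d) j)
  -- the coefficients through the rescaled factors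
  have hc : lamCoeffK (KInvStep (d := d) Lc (j + 1)) (E2 d Lc (j + 1)) Lc = fun μ y κ u =>
      ((smStep d Lc (j + 1) * sfStep Lc (j + 1))⁻¹ * ((smStep d Lc j) ^ 2)⁻¹) *
        lamCoeffK (KStepUnit (d := d) Lc (j + 1)) ((smStep d Lc j) ^ 2 • E2 d Lc (j + 1)) Lc μ y κ u := by
    funext μ y κ u
    exact lamCoeffK_unit hsf hsm ht _ _ (fun y z ν b => E2_inr (j + 1) y z ν b) Lc μ y κ u
  rw [hc, SLam_smul]
  have hfun : (fun κ u => (cΛ * wΛ d Lc (j + 1)) •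
      (fun κ u => ((smStep d Lc (j + 1) * sfStep Lc (j + 1))⁻¹ * ((smStep d Lc j) ^ 2)⁻¹) •
        SLam Lc (lamCoeffK (KStepUnit (d := d) Lc (j + 1)) ((smStep d Lc j) ^ 2 • E2 d Lc (j + 1)) Lc)
          (fun μ y => hessFFAt ρ Lc μ y) κ u) κ u)
      = fun κ u => ((cΛ * wΛ d Lc (j + 1)) * (((smStep d Lc (j + 1) * sfStep Lc (j + 1))⁻¹ * ((smStep d Lc j) ^ 2)⁻¹))) •
        SLam Lc (lamCoeffK (KStepUnit (d := d) Lc (j + 1)) ((smStep d Lc j) ^ 2 • E2 d Lc (j + 1)) Lc)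
          (fun μ y => hessFFAt ρ Lc μ y) κ u := by
    funext κ u
    rw [smul_smul]
  rw [hfun, unitS_smul_ffOnly _ _ _ _ (fun κ u x y α ν => SLam_hessFFAt_inl_inr _ ρ Lc κ u x y α ν)
    (fun κ u x y ν α => SLam_hessFFAt_inr_inl _ ρ Lc κ u x y ν α) (fun κ u x y ν ν' => SLam_hessFFAt_inr_inr _ ρ Lc κ u x y ν ν')]
  funext κ u
  congr 1
  rw [← mul_assoc]
  exact lam_unit_factor cΛ j

/-- [folklore] **`hS`-SHAPE FOR THE ROOTED LAGRANGE SUMMAND, UNIFORMLY IN `j`, FROM THE K-SLOT'S DECAY HALF** (in-block root `toSite r`,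
`r ∈ box (d+1) Lc`): if the unit-normalised step resolvents decay uniformly (`UnitDecayK d Lc (sfStep Lc) (smStep d Lc) C δ`, `0 < δ` — the wall's
`hK` in the adopted units), then for every member `j + 1` the normalised rooted (P-Λ) summand is a local stencil family with ONE `j`-free constant
(the base module's) and rate `δ/4` (an1's ROOTED `biLoc_hessFFAt` supplies the vertex family; `abs_lamCoeffK_le`, `locStencil_SLam` BY NAME). -/
theorem locStencil_unitS_lamPiece (hLc : 1 ≤ Lc) {r : Fin (d + 1) → ℕ} (hr : r ∈ box (d + 1) Lc) {C δ : ℝ}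
    (hK : UnitDecayK d Lc (sfStep Lc) (smStep d Lc) C δ) (hδ : 0 < δ) (cΛ : ℝ) (j : ℕ) :
    LocStencil (unitS (sfStep Lc (j + 1)) (smStep d Lc (j + 1))
        (fun κ u => (cΛ * wΛ d Lc (j + 1)) •
          SLam Lc (lamCoeffK (KInvStep (d := d) Lc (j + 1)) (E2 d Lc (j + 1)) Lc) (fun μ y => hessFFAt (toSite r) Lc μ y) κ u))
      (|cΛ * (Lc : ℝ) ^ (2 * (d + 1))| *
        ((d + 1 : ℕ) * (((Fintype.card (Fib d) : ℝ) * (C * C) * Zl (d + 1) (δ - δ / 2)) *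
          (2 * (ell (d + 1) Lc : ℝ) ^ 2 * Real.exp (4 * ((d : ℝ) + 1) * Lc * (δ / 2))) * Zl (d + 1) (δ / 2 / 2))))
      (δ / 2 / 2) := by
  rw [unitS_lamPiece_eq]
  have hA : Decays (KStepUnit (d := d) Lc (j + 1)) C δ := hK (j + 1)
  have hE : Decays ((smStep d Lc j) ^ 2 • E2 d Lc (j + 1)) C δ := decays_E2unit (hK j) hδ.le
  have hC : 0 ≤ C := hA.nonneg (Sum.inl 0)
  have hc := abs_lamCoeffK_le hA hE hδ Lc
  have hδ2 : (0 : ℝ) ≤ δ / 2 := by positivity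
  have hQ : VertexFamily (fun μ y => hessFFAt (toSite r) Lc μ y) Lc
      (2 * (ell (d + 1) Lc : ℝ) ^ 2 * Real.exp (4 * ((d : ℝ) + 1) * Lc * (δ / 2))) (δ / 2) :=
    fun μ y => biLoc_hessFFAt hLc μ y hr hδ2
  have hS := locStencil_SLam (N := Lc) hc hQ (by positivity)
    (mul_nonneg (mul_nonneg (Nat.cast_nonneg _) (mul_nonneg hC hC)) (Zl_nonneg (by linarith)))
  exact StepJetData.locStencil_smul _ hS

end Main

end Summit.QuantumFields.BalabanUV.Beta.GAN24.StencilSlotLamRoot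

end
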